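import Literature.NumberTheory.EllipticCurves.LambdaAdicSelmerDataSaturatedTransport
import Literature.NumberTheory.EllipticCurves.ZpExtensionUnramifiedProofs
import Literature.NumberTheory.GaloisRepresentations.DecompositionGroupOfCompletion
import Mathlib.NumberTheory.Padics.PadicVal.Basic
import HarnessLib

/-!
# Clause `(S)` for `𝔖_p(K_∞)`: reduction of the point-divisibility input to Kodaira–Néron finiteness
# and `p`-divisibility of `E₀` over the maximal unramified extension

Topic `NumberTheory/EllipticCurves`; namespaces `Literature.NumberTheory.EllipticCurves` (§1–§2),
`WeierstrassCurve.LambdaAdicSelmerData` (§3). THEOREMS ONLY (no definition, no named fact, no instance, no `sorry`).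

`LambdaAdicSelmerDataSaturatedTransport` reduced clause `(S)` of Howard's place-by-place Selmer criterion (for the
image of the compact control map `f : 𝔖_p(K_∞) → H¹(K, T_𝔮)` at a bad place `v ∤ p`) to the point-divisibility
statement `hdiv(c)`: every `E(K̄_v)`-point `R` rational over the layer completions has a `Q` fixed by the inertia
group with `p^k Q = p^c R`, with `c` UNIFORM in the layer and in `k`. This file reduces `hdiv(c)` further, by pure
group theory, to the two classical arithmetic inputs on `E(K_v^{nr}) = E(K̄_v)^{I_{K_v}}`:

  (KN)  finitely many inertia-fixed representatives of `E(K̄_v)^{I}` modulo an inertia-stable subgroup `E₀`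
        (Kodaira–Néron: `E(K_v^{nr})/E₀(K_v^{nr})` finite, Silverman *AEC* VII.6.1/6.2 — in the tree for the minimal
        model: `kodairaNeron_exists_finset_reducesToNonsingular_of_has{Multiplicative,Additive}ReductionAt`);
  (DIV) `E₀ ∩ E(K̄_v)^{I}` is `p`-divisible (Hensel over `K_v^{nr}` + `Ẽ_ns(k̄)` `p`-divisible + `[p]` bijective
        on `E₁`, Silverman *AEC* VII.2.1–2.2, IV.2.3),

and supplies the uniform exponent: `c = v_p((#T)!)` for the finite set `T` of representatives (pigeonhole on the
multiples `j • R`, `0 ≤ j ≤ #T`, then Bézout between `p^k` and the prime-to-`p` part of `(#T)!`). It also proves the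
layer inclusion `res (I_{K_v}) ≤ Γ_n` for `v ∤ p` (the `ℤ_p`-extension is unramified outside `p`:
`ZpExtension.inertia_le_kerSubgroup_holds`, Neukirch II (9.6) `inertia_adicCompletionPrime_eq_map_absInertia`), so that
layer-rational points are inertia-fixed.

* §1 `AddSubgroup.exists_pow_nsmul_eq_pow_nsmul_of_finset_of_divisible` — abstract: subgroups `A, E₀ ≤ M`, a finite
  set of representatives of `A` modulo `A ⊓ E₀`, `A ⊓ E₀` `p`-divisible ⇒ `∃ c, ∀ k, ∀ R ∈ A, ∃ Q ∈ A, p^k Q = p^c R`.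
* §2 `WeierstrassCurve.localPoints_exists_pow_nsmul_of_kodairaNeron_of_divisible` — the same for
  `A = E(K̄_v)^{I_{K_v}}` (`absInertia`), `E₀` any inertia-stable subgroup of `localPoints V K_v` with (KN), (DIV).
* §3 `ZpExtension.absGaloisRestrict_mem_layerSubgroup_of_mem_absInertia` (`res I_{K_v} ≤ Γ_n`, `v ∤ p`);
  **`LambdaAdicSelmerData.hdiv_of_kodairaNeron_of_divisible`** ((KN)+(DIV) ⇒ `hdiv(c)` for all layers) and
  **`nsmul_localization_proj_toEisensteinH1Linear_mem_unramifiedSubgroup_of_kodairaNeron_of_divisible`** ((KN)+(DIV) at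
  `v` ⇒ `∃ a, ∀ k, p^a • loc_v (proj k (f s)) ∈ H¹_{ur}(K_v, T_𝔮/p^k)`, clause `(S)` at `v`).

References: Silverman, *AEC* (2009), VII.§2 (Props. 2.1, 2.2), Thm. VII.6.1 / Cor. VII.6.2, X.§4; Greenberg, LNM 1716
(1999), §2 (`ℓ ≠ p`); Howard, *Compos. Math.* 140 (2004), Def. 2.1.1, Lemma 2.2.7; Washington, *Cyclotomic Fields*,
Prop. 13.2; Neukirch, *ANT*, II (9.6). No summit statement is proved here.
-/

noncomputable section

open scoped TensorProduct Topology ContRepresentation Classical NumberField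
open Field CategoryTheory NumberField IsDedekindDomain
open Literature.NumberTheory.GaloisRepresentations Literature.NumberTheory.EllipticCurves
open Literature.NumberTheory.GaloisRepresentations.DiscreteGaloisModule (unramifiedSubgroup)
open Literature.NumberTheory.EllipticCurves.ZpExtension (eisensteinLevel)

universe u

/-! ## §1 Uniform divisibility from finitely many representatives and a divisible subgroup -/

namespace AddSubgroup

variable {M : Type*} [AddCommGroup M]

/-- Iterated `p`-division inside a `p`-divisible subgroup. [folklore] -/
private theorem exists_pow_nsmul_eq_of_divisible (B : AddSubgroup M) (p : ℕ)
    (hdiv : ∀ X ∈ B, ∃ Y ∈ B, p • Y = X) (j : ℕ) (X : M) (hX : X ∈ B) :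
    ∃ Y ∈ B, p ^ j • Y = X := by
  induction j generalizing X with
  | zero => exact ⟨X, hX, by rw [pow_zero, one_smul]⟩
  | succ j ih =>
    obtain ⟨Y₁, hY₁, rfl⟩ := hdiv X hX
    obtain ⟨Y, hY, rfl⟩ := ih Y₁ hY₁
    exact ⟨Y, hY, by rw [pow_succ, mul_comm, mul_smul]⟩

/-- **Uniform `p`-divisibility up to a bounded power.** Let `A, E₀ ≤ M` be subgroups of an abelian group, `T` a finite
set such that every `P ∈ A` has `P - t ∈ A ⊓ E₀` for some `t ∈ T` (finitely many cosets of `A ⊓ E₀` meet `A`), and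
suppose `A ⊓ E₀` is `p`-divisible. Then with `c = v_p((#T)!)`: for every `k` and every `R ∈ A` there is `Q ∈ A` with
`p^k Q = p^c R`. (Pigeonhole on `j • R`, `0 ≤ j ≤ #T`: some `d • R ∈ A ⊓ E₀` with `1 ≤ d ≤ #T`, so `(#T)! • R ∈ A ⊓ E₀`
is `p^∞`-divisible in `A`; write `(#T)! = p^c u` with `p ∤ u` and use Bézout for `p^k, u`.) The shape of
"`E(K^{nr})/E₀(K^{nr})` finite and `E₀(K^{nr})` `p`-divisible ⇒ `p^c E(K^{nr}) ⊆ p^k E(K^{nr})`".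
[cite: SilvermanAEC2009, Thm. VII.6.1 and Cor. VII.6.2] [cite: GreenbergLNM1716, §2] -/
theorem exists_pow_nsmul_eq_pow_nsmul_of_finset_of_divisible (A E₀ : AddSubgroup M) {p : ℕ} (hp : p.Prime)
    (T : Finset M) (hT : ∀ P ∈ A, ∃ t ∈ T, P - t ∈ A ⊓ E₀)
    (hdiv : ∀ X ∈ A ⊓ E₀, ∃ Y ∈ A ⊓ E₀, p • Y = X) :
    ∃ c : ℕ, ∀ (k : ℕ) (R : M), R ∈ A → ∃ Q ∈ A, p ^ k • Q = p ^ c • R := by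
  set N : ℕ := T.card.factorial with hN
  have hN0 : N ≠ 0 := Nat.factorial_ne_zero _
  -- every `R ∈ A` has `N • R ∈ A ⊓ E₀`
  have hmul : ∀ R ∈ A, N • R ∈ A ⊓ E₀ := by
    intro R hR
    have hex : ∀ j : ℕ, ∃ t ∈ T, j • R - t ∈ A ⊓ E₀ := fun j ↦ hT _ (A.nsmul_mem hR j)
    choose f hfT hf using hex
    obtain ⟨j₁, hj₁, j₂, hj₂, hne, hfeq⟩ := Finset.exists_ne_map_eq_of_card_lt_of_maps_to
      (s := Finset.range (T.card + 1)) (t := T) (by rw [Finset.card_range]; exact Nat.lt_succ_self _)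
      (fun j _ ↦ hfT j)
    -- `d • R ∈ A ⊓ E₀` for `d = |j₂ - j₁|`, `1 ≤ d ≤ #T`
    have key : ∀ {a b : ℕ}, a < b → b ∈ Finset.range (T.card + 1) → f a = f b → N • R ∈ A ⊓ E₀ := by
      intro a b hab hb hfab
      have hd : (b - a) • R ∈ A ⊓ E₀ := by
        have h : (b - a) • R = (b • R - f b) - (a • R - f a) := by
          rw [hfab, sub_sub_sub_cancel_right, eq_sub_iff_add_eq, ← add_nsmul, Nat.sub_add_cancel hab.le]
        rw [h]
        exact sub_mem (hf b) (hf a)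
      have hdvd : (b - a) ∣ N :=
        Nat.dvd_factorial (Nat.sub_pos_of_lt hab) (by
          have := Finset.mem_range.1 hb
          omega)
      obtain ⟨e, he⟩ := hdvd
      rw [he, mul_comm, ← smul_smul]
      exact (A ⊓ E₀).nsmul_mem hd e
    rcases lt_or_gt_of_ne hne with h | h
    · exact key h hj₂ hfeq
    · exact key h hj₁ hfeq.symm
  -- `N = p^c u` with `p ∤ u`
  refine ⟨N.factorization p, fun k R hR ↦ ?_⟩
  set c : ℕ := N.factorization p with hc
  set u : ℕ := N / p ^ c with hu
  have hNcu : p ^ c * u = N := Nat.ordProj_mul_ordCompl_eq_self N p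
  have hpu : Nat.Coprime p u := Nat.coprime_ordCompl hp hN0
  have hcop : IsCoprime ((p : ℤ) ^ k) (u : ℤ) := by
    rw [← Nat.cast_pow, Nat.isCoprime_iff_coprime]
    exact Nat.Coprime.pow_left k hpu
  obtain ⟨a, b, hab⟩ := hcop
  -- `p^k Y = N • R` with `Y ∈ A`
  obtain ⟨Y, hY, hYk⟩ := (A ⊓ E₀).exists_pow_nsmul_eq_of_divisible p hdiv k (N • R) (hmul R hR)
  refine ⟨b • Y + (a * (p : ℤ) ^ c) • R, A.add_mem (A.zsmul_mem (AddSubgroup.mem_inf.1 hY).1 b) (A.zsmul_mem hR _),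
    ?_⟩
  -- `p^k (b Y + a p^c R) = b N R + a p^c p^k R = p^c (b u + a p^k) R = p^c R`
  have h1 : p ^ k • (b • Y + (a * (p : ℤ) ^ c) • R) = (b * N + (p : ℤ) ^ k * (a * (p : ℤ) ^ c)) • R := by
    rw [smul_add, smul_comm (p ^ k) b Y, hYk, ← natCast_zsmul R N, ← natCast_zsmul ((a * (p : ℤ) ^ c) • R) (p ^ k),
      smul_smul, smul_smul, ← add_smul, Nat.cast_pow]
  have h2 : (b * N + (p : ℤ) ^ k * (a * (p : ℤ) ^ c) : ℤ) = (p : ℤ) ^ c := by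
    rw [← hNcu]
    push_cast
    linear_combination ((p : ℤ) ^ c) * hab
  rw [h1, h2, ← Nat.cast_pow, natCast_zsmul]

end AddSubgroup

/-! ## §2 The same for the inertia-fixed points of `E(K̄_v)` -/

namespace WeierstrassCurve

variable {K : Type u} [Field K] [NumberField K] (V : WeierstrassCurve K) [V.IsElliptic]

omit [V.IsElliptic] in
/-- **`p^c E(K_v^{nr}) ⊆ p^k E(K_v^{nr})` from (KN) and (DIV).** Let `I = absInertia K_v ≤ Γ_{K_v}` act on
`E(K̄_v) = localPoints V K_v`, and let `E₀` be a subgroup of `E(K̄_v)` such that (KN) every `I`-fixed point differs from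
some element of a finite set `T` by an `I`-FIXED element of `E₀`, and (DIV) every `I`-fixed element of `E₀` is `p • Y`
for an `I`-fixed `Y ∈ E₀`. Then there is `c` (namely `v_p((#T)!)`) such that for all `k` every `I`-fixed `R` has an
`I`-fixed `Q` with `p^k Q = p^c R`. (`E(K̄_v)^{I} = E(K_v^{nr})`; for the minimal model's `E₀` the inputs are
Kodaira–Néron VII.6.2 over `K_v^{nr}` and the `p`-divisibility of `E₀(K_v^{nr})`, VII.2.1–2.2.)
[cite: SilvermanAEC2009, Thm. VII.6.1, Cor. VII.6.2, Props. VII.2.1–2.2] [cite: GreenbergLNM1716, §2] -/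
theorem localPoints_exists_pow_nsmul_of_kodairaNeron_of_divisible {v : HeightOneSpectrum (𝓞 K)} {p : ℕ}
    (hp : p.Prime) (E₀ : AddSubgroup (localPoints V (v.adicCompletion K))) (T : Finset (localPoints V (v.adicCompletion K)))
    (hT : ∀ P : localPoints V (v.adicCompletion K), (∀ σ ∈ absInertia (v.adicCompletion K), σ • P = P) →
      ∃ t ∈ T, (∀ σ ∈ absInertia (v.adicCompletion K), σ • (P - t) = P - t) ∧ P - t ∈ E₀)
    (hdiv : ∀ X ∈ E₀, (∀ σ ∈ absInertia (v.adicCompletion K), σ • X = X) →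
      ∃ Y ∈ E₀, (∀ σ ∈ absInertia (v.adicCompletion K), σ • Y = Y) ∧ p • Y = X) :
    ∃ c : ℕ, ∀ (k : ℕ) (R : localPoints V (v.adicCompletion K)),
      (∀ σ ∈ absInertia (v.adicCompletion K), σ • R = R) →
      ∃ Q : localPoints V (v.adicCompletion K),
        (∀ σ ∈ absInertia (v.adicCompletion K), σ • Q = Q) ∧ p ^ k • Q = p ^ c • R := by
  -- the subgroup of inertia-fixed points
  let A : AddSubgroup (localPoints V (v.adicCompletion K)) :=
    { carrier := {P | ∀ σ ∈ absInertia (v.adicCompletion K), σ • P = P}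
      add_mem' := fun {a b} ha hb σ hσ ↦ by rw [smul_add, ha σ hσ, hb σ hσ]
      zero_mem' := fun σ _ ↦ smul_zero σ
      neg_mem' := fun {a} ha σ hσ ↦ by rw [smul_neg, ha σ hσ] }
  have hA : ∀ P, P ∈ A ↔ ∀ σ ∈ absInertia (v.adicCompletion K), σ • P = P := fun P ↦ Iff.rfl
  obtain ⟨c, hc⟩ := A.exists_pow_nsmul_eq_pow_nsmul_of_finset_of_divisible E₀ hp T
    (fun P hP ↦ by
      obtain ⟨t, htT, htI, htE⟩ := hT P ((hA P).1 hP)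
      exact ⟨t, htT, AddSubgroup.mem_inf.2 ⟨(hA _).2 htI, htE⟩⟩)
    (fun X hX ↦ by
      obtain ⟨Y, hYE, hYI, hYX⟩ := hdiv X (AddSubgroup.mem_inf.1 hX).2 ((hA X).1 (AddSubgroup.mem_inf.1 hX).1)
      exact ⟨Y, AddSubgroup.mem_inf.2 ⟨(hA Y).2 hYI, hYE⟩, hYX⟩)
  exact ⟨c, fun k R hR ↦ by
    obtain ⟨Q, hQ, hQk⟩ := hc k R ((hA R).2 hR)
    exact ⟨Q, (hA Q).1 hQ, hQk⟩⟩

end WeierstrassCurve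

/-! ## §3 The layers are unramified at `v ∤ p`; clause `(S)` for `𝔖_p(K_∞)` from (KN) + (DIV) -/

namespace Literature.NumberTheory.EllipticCurves.ZpExtension

variable {K : Type u} [Field K] [NumberField K] {p : ℕ} [hp : Fact p.Prime] (κ : ZpExtension K p)

/-- **The local inertia group restricts into every layer subgroup**: for a finite place `v ∤ p` and every `n`,
`res (I_{K_v}) ≤ Γ_n = Gal(K̄/K_n)` — a `ℤ_p`-extension is unramified outside `p`
(`inertia_le_kerSubgroup_holds`: `I_𝔓 ≤ ker κ ≤ Γ_n` for the primes `𝔓` of `\bar ℤ_K` above `v`; `I_{𝔓₀} = res (I_{K_v})`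
for the prime `𝔓₀` of the completion, Neukirch II (9.6)). [cite: Washington1997, Prop. 13.2] [cite: NeukirchANT1999, Ch. II §9 Prop. (9.6)] -/
theorem absGaloisRestrict_mem_layerSubgroup_of_mem_absInertia {v : HeightOneSpectrum (𝓞 K)}
    (hpv : ((p : ℕ) : 𝓞 K) ∉ v.asIdeal) (n : ℕ) {τ : absoluteGaloisGroup (v.adicCompletion K)}
    (hτ : τ ∈ absInertia (v.adicCompletion K)) :
    absGaloisRestrict K (v.adicCompletion K) τ ∈ κ.layerSubgroup n := by
  refine κ.kerSubgroup_le_layerSubgroup n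
    (inertia_le_kerSubgroup_holds K p κ hpv (adicCompletionPrime_mem_primesAbove K v) ?_)
  rw [inertia_adicCompletionPrime_eq_map_absInertia]
  exact Subgroup.mem_map_of_mem _ hτ

end Literature.NumberTheory.EllipticCurves.ZpExtension

namespace WeierstrassCurve.LambdaAdicSelmerData

variable {K : Type u} [Field K] [NumberField K] {V : WeierstrassCurve K} [V.IsElliptic] {p : ℕ} [hp : Fact p.Prime]
  {κ : ZpExtension K p} {γ : absoluteGaloisGroup K} (D : V.LambdaAdicSelmerData κ γ) {m : ℕ} (hm : 1 ≤ m)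

omit [V.IsElliptic] in
/-- **`hdiv(c)` for all layers from (KN) + (DIV) at `v ∤ p`.** With `E₀ ≤ E(K̄_v)` inertia-stable as in §2 (finitely
many inertia-fixed representatives of `E(K_v^{nr})` modulo `E₀`; `E₀ ∩ E(K_v^{nr})` `p`-divisible), there is a
uniform `c` such that for every layer `n`, level `k` and every `R ∈ E(K̄_v)` rational over the completion of `K_n` cut
out by the chosen embedding (`H_{K_v} = res⁻¹ Γ_n ⊇ I_{K_v}`, §3), some `Q` fixed by `I_{K_v}` has `p^k Q = p^c R` — the
hypothesis `hdiv` of `nsmul_proj_conjMap_eq_zero_of_divisible` /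
`nsmul_localization_proj_toEisensteinH1Linear_mem_unramifiedSubgroup_of_divisible`.
[cite: SilvermanAEC2009, Thm. VII.6.1, Cor. VII.6.2, Props. VII.2.1–2.2] [cite: Washington1997, Prop. 13.2] -/
theorem hdiv_of_kodairaNeron_of_divisible {v : HeightOneSpectrum (𝓞 K)} (hpv : ((p : ℕ) : 𝓞 K) ∉ v.asIdeal)
    (E₀ : AddSubgroup (localPoints V (v.adicCompletion K))) (T : Finset (localPoints V (v.adicCompletion K)))
    (hT : ∀ P : localPoints V (v.adicCompletion K), (∀ σ ∈ absInertia (v.adicCompletion K), σ • P = P) →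
      ∃ t ∈ T, (∀ σ ∈ absInertia (v.adicCompletion K), σ • (P - t) = P - t) ∧ P - t ∈ E₀)
    (hdiv : ∀ X ∈ E₀, (∀ σ ∈ absInertia (v.adicCompletion K), σ • X = X) →
      ∃ Y ∈ E₀, (∀ σ ∈ absInertia (v.adicCompletion K), σ • Y = Y) ∧ p • Y = X) :
    ∃ c : ℕ, ∀ (n k : ℕ) (R : localPoints V (v.adicCompletion K)),
      (∀ τ ∈ localSubgroupOfEmb (κ.layerSubgroup n) (closureEmb (K := K) (v.adicCompletion K)), τ • R = R) →
      ∃ Q : localPoints V (v.adicCompletion K),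
        (∀ τ ∈ absInertia (v.adicCompletion K),
          τ ∈ localSubgroupOfEmb (κ.layerSubgroup n) (closureEmb (K := K) (v.adicCompletion K)) → τ • Q = Q) ∧
        p ^ k • Q = p ^ c • R := by
  obtain ⟨c, hc⟩ := V.localPoints_exists_pow_nsmul_of_kodairaNeron_of_divisible hp.out E₀ T hT hdiv
  refine ⟨c, fun n k R hR ↦ ?_⟩
  -- `R` is inertia-fixed: `res (I_{K_v}) ≤ Γ_n`
  obtain ⟨Q, hQI, hQ⟩ := hc k R fun σ hσ ↦ hR σ (κ.absGaloisRestrict_mem_layerSubgroup_of_mem_absInertia hpv n hσ)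
  exact ⟨Q, fun τ hτ _ ↦ hQI τ hτ, hQ⟩

section Linear

variable (t : ∀ k, (V.torsionGaloisModule ((p : ℤ) ^ (k + 1))).toContRepresentation →ⁱL
    (V.torsionGaloisModule ((p : ℤ) ^ k)).toContRepresentation)
  (ht : ∀ k (P : geomTorsion V ((p : ℤ) ^ (k + 1))), t k P = V.geomTorsionReduce p k P)
  (I : ZpExtension.EisensteinH1Data (κ.unitTwist (-1)) (fun k ↦ V.torsionGaloisModule ((p : ℤ) ^ k)) t hm)

include ht

/-- **Clause `(S)` at `v ∤ p` for the image of `𝔖_p(K_∞)`, from (KN) + (DIV).** For `h = f s`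
(`f = toEisensteinH1Linear`) and a finite place `v ∤ p` at which `E(K̄_v)` admits an inertia-stable subgroup `E₀`
with finitely many inertia-fixed representatives of `E(K_v^{nr})` modulo `E₀` (Kodaira–Néron) and
`E₀ ∩ E(K_v^{nr})` `p`-divisible: `∃ a, ∀ k, p^a • loc_v (proj k h) ∈ H¹_{ur}(K_v, T_𝔮/p^k)` — the hypothesis `hS`
of `EisensteinH1Data.mem_ordinarySelmer_of_local` at `v`.
[cite: Howard2004HeegnerKolyvagin, Def. 2.1.1, §2.2 Lemma 2.2.7 and Prop. 2.2.8]
[cite: SilvermanAEC2009, Thm. VII.6.1, Cor. VII.6.2, X.§4 proof of Thm. 4.2(b)] [cite: GreenbergLNM1716, §2] -/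
theorem nsmul_localization_proj_toEisensteinH1Linear_mem_unramifiedSubgroup_of_kodairaNeron_of_divisible
    (hγ : κ.IsTopGenerator γ) (hE : ∀ P : V.toAffine.Point, p • P = 0 → P = 0) (s : D.S)
    {v : HeightOneSpectrum (𝓞 K)} (hpv : ((p : ℕ) : 𝓞 K) ∉ v.asIdeal)
    (E₀ : AddSubgroup (localPoints V (v.adicCompletion K))) (T : Finset (localPoints V (v.adicCompletion K)))
    (hT : ∀ P : localPoints V (v.adicCompletion K), (∀ σ ∈ absInertia (v.adicCompletion K), σ • P = P) →
      ∃ t ∈ T, (∀ σ ∈ absInertia (v.adicCompletion K), σ • (P - t) = P - t) ∧ P - t ∈ E₀)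
    (hdiv : ∀ X ∈ E₀, (∀ σ ∈ absInertia (v.adicCompletion K), σ • X = X) →
      ∃ Y ∈ E₀, (∀ σ ∈ absInertia (v.adicCompletion K), σ • Y = Y) ∧ p • Y = X) :
    ∃ a : ℕ, ∀ k,
      p ^ a • galoisCohomology.localization
          ((κ.unitTwist (-1)).eisensteinTwist (V.torsionGaloisModule ((p : ℤ) ^ k)) hm k) (Sum.inr v) 1
          (I.proj k (D.toEisensteinH1Linear hm t ht I hγ hE s)) ∈
        unramifiedSubgroup
          (GaloisRep.toLocal v ((κ.unitTwist (-1)).eisensteinTwist (V.torsionGaloisModule ((p : ℤ) ^ k)) hm k)) 1 := by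
  obtain ⟨c, hc⟩ := hdiv_of_kodairaNeron_of_divisible (κ := κ) hpv E₀ T hT hdiv
  exact ⟨c, fun k ↦ D.nsmul_localization_proj_toEisensteinH1Linear_mem_unramifiedSubgroup_of_divisible hm t ht I hγ
    hE s c hc k⟩

end Linear

end WeierstrassCurve.LambdaAdicSelmerData

end
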